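import Summits.CriticalPhenomena.PercolationContinuityZ3.Theorems.FK.MagnetizationFieldDerivative
import HarnessLib

/-!
# `m(β,·)` IS DIFFERENTIABLE AT `h > 0` IF AND ONLY IF `σ²(β,·)` IS CONTINUOUS AT `h`; THE LEFT DERIVATIVE IS `β σ²(β,h⁻)`
# (the two-sided form of Ellis 2006, Lemma V.7.4 / eq. (5.28), without Lee–Yang)

Claimed R42 (8)(c) in the cell INBOX at 2026-08-28T21:27:52Z by fkp-10a gen 356 (NEW CLAIM #1 of the gen), addressed to coordinator fk-4 (next seated gen; (ι) in force for windows); lineage row FO-10a-g356 (self-suggested), package g356-susceptibility, label FR-F.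
Helper file of the `fk-continuity` build cell (bschramm lane; `--supports stmt-CriticalPhenomena-4575`); builds on
p205010 (kernel theorem, internal audit signed; external expert review pending). No definitions, no named facts, no
sorries; standard axioms. UNCONDITIONAL (nearest-neighbour Ising model on `ℤ^d`).

Notation as in `MagnetizationFieldDerivative`: `m(h) = magnetizationInField d β h`, `σ²(β,h) = Σ'_z u(z;h)`,
`u(z;h) = ⟨σ_{{0}∆{z}}⟩⁺_{β,h} − ⟨σ_0⟩⁺_{β,h}⟨σ_z⟩⁺_{β,h}`. The companion file proves `∂⁺m/∂h = β σ²(β,h)` and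
differentiability wherever `σ²(β,·)` is left-continuous. Here the converse: `σ²(β,·)` is nonincreasing on `(0,∞)`, so
it has a left limit `σ²(β,h⁻) = inf_{0<y<h} σ²(β,y) ≥ σ²(β,h)` at every `h > 0` (`tendsto_tsum_plusTruncated_nhdsLT`), and

* `not_differentiableAt_magnetizationInField_of_jump` — if `σ²(β,·)` JUMPS at `h` (some `a > σ²(β,h)` bounds `σ²(β,y)`
  from below for `y ↑ h`), then `m(β,·)` is NOT differentiable at `h`: the chords `slope m y y' ≥ β σ²(β,y')` (lower
  chord bound) force every left chord at `h` to be `≥ β a > β σ²(β,h) = ∂⁺m/∂h`;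
* **`differentiableAt_magnetizationInField_iff`** — for `β > 0`, `h > 0`:
  `m(β,·)` differentiable at `h` ⇔ `σ²(β,·)` continuous from the left at `h` ⇔ `σ²(β,·)` continuous at `h`
  (`differentiableAt_magnetizationInField_iff_continuousAt`);
* `hasDerivWithinAt_magnetizationInField_Iic` — **the LEFT derivative of `m(β,·)` at `h > 0` exists and equals
  `β σ²(β,h⁻) = β inf_{0<y<h} σ²(β,y)`**; so both one-sided field-derivatives of the magnetisation exist at every `h > 0`
  and `∂⁻m/∂h − ∂⁺m/∂h = β (σ²(β,h⁻) − σ²(β,h)) ≥ 0` is exactly the jump of the susceptibility sum.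

## References

* R. S. Ellis, *Entropy, Large Deviations, and Statistical Mechanics*, Springer (1985/2006), Lemma V.7.3 (b), (c),
  Lemma V.7.4, eq. (5.28). [Ellis2006]
* R. T. Rockafellar, *Convex Analysis*, Princeton (1970), Thm. 24.1, Thm. 25.3. [Rockafellar1970]
* A. D. Sokal, J. Stat. Phys. 25 (1981) 25–50, Appendix. [SokalMoreInequalities1981]
-/

noncomputable section

namespace Summit.CriticalPhenomena.PercolationContinuityZ3.Theorems.FK

namespace IsingSusceptibility

open MeasureTheory Filter Topology Finset Set
open scoped symmDiff
open Literature.Probability.LatticeModels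
open Summit.CriticalPhenomena.PercolationContinuityZ3.Theorems.FK.IsingCLT
open Summit.CriticalPhenomena.PercolationContinuityZ3.Theorems.FK.ConcaveLimit

variable {d : ℕ}

/-- **A jump of `σ²(β,·)` at `h` forbids differentiability of `m(β,·)` at `h`** (`β > 0`, `h > 0`): if some
`a > σ²(β,h)` satisfies `a ≤ σ²(β,y)` for all `y < h` close to `h`, then `m(β,·)` is not differentiable at `h`.
[cite: Ellis2006, Lemma V.7.4 (a), eq. (5.28); Rockafellar1970, Thm. 24.1] -/
theorem not_differentiableAt_magnetizationInField_of_jump {β h : ℝ} (hβ : 0 < β) (hh : 0 < h) {a : ℝ}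
    (ha : ∑' z : Site d, (plusCorr d β h ({0} ∆ {z}) - plusCorr d β h {0} * plusCorr d β h {z}) < a)
    (hjump : ∀ᶠ y in 𝓝[<] h, a ≤ ∑' z : Site d, (plusCorr d β y ({0} ∆ {z}) - plusCorr d β y {0} * plusCorr d β y {z})) :
    ¬ DifferentiableAt ℝ (fun t => magnetizationInField d β t) h := by
  intro hd
  have hD := deriv_magnetizationInField_eq hβ hh hd
  set m : ℝ → ℝ := fun t => magnetizationInField d β t with hm
  -- left chords at `h` converge to the derivative
  have hslope : Tendsto (fun y => slope m y h) (𝓝[<] h) (𝓝 (deriv m h)) := by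
    have := (hasDerivAt_iff_tendsto_slope.1 hd.hasDerivAt).mono_left (nhdsWithin_mono h fun y (hy : y < h) => hy.ne)
    exact this.congr fun y => slope_comm m h y
  -- every left chord from a point of the jump region is `≥ β a`
  have hbig : ∀ᶠ y in 𝓝[<] h, β * a ≤ slope m y h := by
    filter_upwards [Ioo_mem_nhdsLT hh] with y hy
    obtain ⟨hy0, hyh⟩ := hy
    -- chords `slope m y y'` with `y < y' < h`, `y'` in the jump region, are `≥ β σ²(β,y') ≥ β a`; let `y' ↑ h`
    have hcont : ContinuousAt m h := hd.continuousAt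
    have hlim : Tendsto (fun y' => slope m y y') (𝓝[<] h) (𝓝 (slope m y h)) := by
      simp only [slope_def_field]
      refine ((hcont.tendsto.mono_left nhdsWithin_le_nhds).sub tendsto_const_nhds).div
        ((continuous_id.tendsto h |>.mono_left nhdsWithin_le_nhds).sub tendsto_const_nhds) (sub_ne_zero.2 hyh.ne')
    refine ge_of_tendsto hlim ?_
    filter_upwards [Ioo_mem_nhdsLT hyh, hjump] with y' hy' hjy'
    exact (mul_le_mul_of_nonneg_left hjy' hβ.le).trans (le_slope_magnetizationInField hβ hy0.le hy'.1)
  have hge : β * a ≤ deriv m h := ge_of_tendsto hslope hbig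
  rw [hD] at hge
  nlinarith

/-- **`σ²(β,·)` has a left limit at every `h > 0`**: `σ²(β,y) → inf_{0<y'<h} σ²(β,y')` as `y ↑ h` (it is nonincreasing
on `(0,∞)` and bounded below by `σ²(β,h)` there). [cite: Ellis2006, Lemma V.7.3 (b)] -/
theorem tendsto_tsum_plusTruncated_nhdsLT {β h : ℝ} (hβ : 0 < β) (hh : 0 < h) :
    Tendsto (fun y => ∑' z : Site d, (plusCorr d β y ({0} ∆ {z}) - plusCorr d β y {0} * plusCorr d β y {z}))
      (𝓝[<] h) (𝓝 (sInf ((fun y => ∑' z : Site d,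
        (plusCorr d β y ({0} ∆ {z}) - plusCorr d β y {0} * plusCorr d β y {z})) '' Ioo 0 h))) := by
  refine ((antitoneOn_tsum_plusTruncated (d := d) hβ).mono fun y (hy : y ∈ Ioo 0 h) => hy.1).tendsto_nhdsWithin_Ioo_left
    ⟨h / 2, by constructor <;> linarith⟩ ⟨∑' z : Site d, (plusCorr d β h ({0} ∆ {z}) - plusCorr d β h {0} * plusCorr d β h {z}), ?_⟩
  rintro _ ⟨y, hy, rfl⟩
  exact antitoneOn_tsum_plusTruncated (d := d) hβ hy.1 hh hy.2.le

/-- The left limit dominates the value: `σ²(β,h) ≤ inf_{0<y<h} σ²(β,y)`. [cite: Ellis2006, Lemma V.7.3 (b)] -/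
theorem tsum_plusTruncated_le_sInf {β h : ℝ} (hβ : 0 < β) (hh : 0 < h) :
    ∑' z : Site d, (plusCorr d β h ({0} ∆ {z}) - plusCorr d β h {0} * plusCorr d β h {z}) ≤
      sInf ((fun y => ∑' z : Site d, (plusCorr d β y ({0} ∆ {z}) - plusCorr d β y {0} * plusCorr d β y {z})) '' Ioo 0 h) := by
  refine le_csInf ⟨_, h / 2, ⟨by linarith, by linarith⟩, rfl⟩ ?_
  rintro _ ⟨y, hy, rfl⟩
  exact antitoneOn_tsum_plusTruncated (d := d) hβ hy.1 hh hy.2.le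

/-- **THE LEFT DERIVATIVE OF THE MAGNETISATION**: for `β > 0`, `h > 0`, `m(β,·)` has left derivative
`β σ²(β,h⁻) = β inf_{0<y<h} σ²(β,y)` at `h` (chords from the left are squeezed between `β σ²(β,h'')` at interior points
and `β σ²(β,y)`). [cite: Ellis2006, Lemma V.7.4 (a); Rockafellar1970, Thm. 24.1] -/
theorem hasDerivWithinAt_magnetizationInField_Iic {β h : ℝ} (hβ : 0 < β) (hh : 0 < h) :
    HasDerivWithinAt (fun t => magnetizationInField d β t)
      (β * sInf ((fun y => ∑' z : Site d,
        (plusCorr d β y ({0} ∆ {z}) - plusCorr d β y {0} * plusCorr d β y {z})) '' Ioo 0 h)) (Iic h) h := by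
  have hlim := tendsto_tsum_plusTruncated_nhdsLT (d := d) hβ hh
  rw [← hasDerivWithinAt_Iio_iff_Iic]
  -- squeeze of the left chords: `β σ²(β,y') ≤ slope m y y'` for `y < y' < h` gives, letting `y' ↑ h` (the concave `m`
  -- is continuous on the open half-line), `β σ²(β,h⁻) ≤ slope m y h`; and `slope m y h ≤ β σ²(β,y) → β σ²(β,h⁻)`.
  have hconc := concaveOn_magnetizationInField (d := d) hβ.le
  have hcont : ContinuousAt (fun t => magnetizationInField d β t) h :=
    (hconc.continuousOn_interior.continuousAt (by rw [interior_Ici]; exact Ioi_mem_nhds hh))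
  refine hasDerivWithinAt_Iio_of_slope_squeeze
    (u := fun y => β * ∑' z : Site d, (plusCorr d β y ({0} ∆ {z}) - plusCorr d β y {0} * plusCorr d β y {z})) ?_ ?_ ?_
  · filter_upwards [Ioo_mem_nhdsLT hh] with y hy
    have hlimy : Tendsto (fun y' => slope (fun t => magnetizationInField d β t) y y') (𝓝[<] h)
        (𝓝 (slope (fun t => magnetizationInField d β t) y h)) := by
      simp only [slope_def_field]
      exact ((hcont.tendsto.mono_left nhdsWithin_le_nhds).sub tendsto_const_nhds).div
        ((continuous_id.tendsto h |>.mono_left nhdsWithin_le_nhds).sub tendsto_const_nhds) (sub_ne_zero.2 hy.2.ne')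
    refine le_of_tendsto_of_tendsto (hlim.const_mul β) hlimy ?_
    filter_upwards [Ioo_mem_nhdsLT hy.2] with y' hy'
    exact le_slope_magnetizationInField hβ hy.1.le hy'.1
  · filter_upwards [Ioo_mem_nhdsLT hh] with y hy
    exact slope_magnetizationInField_le hβ hy.1.le hy.2 (summable_plusTruncated_of_pos_field hβ hy.1)
  · exact hlim.const_mul β

/-- **`m(β,·)` IS DIFFERENTIABLE AT `h > 0` IFF `σ²(β,·)` IS LEFT-CONTINUOUS AT `h`** (`β > 0`); then
`m'(h) = β σ²(β,h)` (`deriv_magnetizationInField_eq`). [cite: Ellis2006, Lemma V.7.4 (a), eq. (5.28); Rockafellar1970, Thm. 25.3] -/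
theorem differentiableAt_magnetizationInField_iff {β h : ℝ} (hβ : 0 < β) (hh : 0 < h) :
    DifferentiableAt ℝ (fun t => magnetizationInField d β t) h ↔
      ContinuousWithinAt
        (fun y => ∑' z : Site d, (plusCorr d β y ({0} ∆ {z}) - plusCorr d β y {0} * plusCorr d β y {z})) (Iio h) h := by
  refine ⟨fun hd => ?_, fun hc => (hasDerivAt_magnetizationInField_of_continuousWithinAt hβ hh hc).differentiableAt⟩
  have hlim := tendsto_tsum_plusTruncated_nhdsLT (d := d) hβ hh
  have hle := tsum_plusTruncated_le_sInf (d := d) hβ hh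
  rcases hle.eq_or_lt with heq | hlt
  · rw [ContinuousWithinAt, heq]; exact hlim
  · exfalso
    refine not_differentiableAt_magnetizationInField_of_jump hβ hh hlt ?_ hd
    filter_upwards [Ioo_mem_nhdsLT hh] with y hy
    exact csInf_le ⟨∑' z : Site d, (plusCorr d β h ({0} ∆ {z}) - plusCorr d β h {0} * plusCorr d β h {z}), by
      rintro _ ⟨y', hy', rfl⟩; exact antitoneOn_tsum_plusTruncated (d := d) hβ hy'.1 hh hy'.2.le⟩ ⟨y, hy, rfl⟩

/-- **… IFF `σ²(β,·)` IS CONTINUOUS AT `h`** (right-continuity being automatic, `tendsto_tsum_plusTruncated_nhdsWithin_Ici`).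
[cite: Ellis2006, Lemma V.7.4 (a), eq. (5.28)] -/
theorem differentiableAt_magnetizationInField_iff_continuousAt {β h : ℝ} (hβ : 0 < β) (hh : 0 < h) :
    DifferentiableAt ℝ (fun t => magnetizationInField d β t) h ↔
      ContinuousAt (fun y => ∑' z : Site d, (plusCorr d β y ({0} ∆ {z}) - plusCorr d β y {0} * plusCorr d β y {z})) h := by
  rw [differentiableAt_magnetizationInField_iff hβ hh, continuousAt_iff_continuous_left_right,
    ← continuousWithinAt_Iio_iff_Iic]
  exact ⟨fun hc => ⟨hc, tendsto_tsum_plusTruncated_nhdsWithin_Ici hβ.le hh.le (summable_plusTruncated_of_pos_field hβ hh)⟩,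
    fun hc => hc.1⟩

end IsingSusceptibility

end Summit.CriticalPhenomena.PercolationContinuityZ3.Theorems.FK

end
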